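import Summits.Ventures.LatticeQCDFlow.Scaling.FlowLadderEquivariantCeiling
import Summits.Ventures.LatticeQCDFlow.Scaling.FlowHubSchemeFloor

/-!
HONEST FRAMING: exact (Metropolis-corrected) sampling algorithms for lattice gauge theory; figures
of merit are autocorrelation/cost numbers at stated couplings and volumes; no continuum-physics
claim.

# FlowHubEquivariantCeiling — NO MAP ON THE HUB EDGES BEATS THE LINEAR LAW: FOR EVERY FAMILY OF BIJECTIONS `φ_k`, EVERY
# ALLOCATION `w` OF THE UPDATES AND EVERY SET `B`, WITH THE IMAGES `A_{k+1} = φ_k(B)` AT THE COLD LEVELS,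
# `Gap(t·GSw^φ + (1−t)·Upd_w M) ≤ (t·min{μ_0(B),μ_0(Bᶜ)} + (1−t)Σ_k w_{k+1}Q_{k+1}(A_{k+1},A_{k+1}ᶜ))/Σ_kμ_{k+1}(A_{k+1})μ_{k+1}(A_{k+1}ᶜ)`;
# IMAGES FROZEN ⇒ `Gap ≤ t·min{μ_0(B),μ_0(Bᶜ)}/(K·v)` — THE HANDOVER CEILING OF `Scaling/ExchangeSchemeHandoverCeiling`
# WITHOUT THE SECTOR-PRESERVING HYPOTHESIS (lean-2 GEN-21, ours)

Venture-side (OURS).  Cell `lqcd-flow` (pub-lqcd), unit `pub-lqcd-lean-2-g21`, 2026-08-26.  Chapter I, thirteenth file: the hub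
twin of `Scaling/FlowLadderEquivariantCeiling`.  The two-sided linear law of `Scaling/FlowHubSchemeFloor` needed
sector-preserving maps for its CEILING half (the count `#{k : x_k ∈ A}` must be invariant under the map swaps).  In the star
coordinates of that file (`Ψ(x)_0 = x_0`, `Ψ(x)_{k+1} = φ_k⁻¹x_{k+1}`) the map-assisted star IS the identity-map star for the
pulled-back laws `ν_{k+1} = μ_{k+1}∘φ_k`, whose handover ceiling (`Scaling/ExchangeSchemeHandoverCeiling`, one set `B`)
pulls back to the IMAGE family `A_0 = B`, `A_{k+1} = φ_k(B)` — the count `1[x_0 ∈ B] + Σ_k 1[x_{k+1} ∈ φ_k(B)]` is what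
the map swaps preserve.

## What is proved

* **`flowHubEquivariant_spectralGap_le`** — every `φ`, every probability vector `w`, `0 ≤ t ≤ 1`, every `B` with
  `Σ_kμ_{k+1}(φ_kB)μ_{k+1}((φ_kB)ᶜ) > 0`: `Gap ≤ (t·min{μ_0(B),μ_0(Bᶜ)} + (1−t)Σ_kw_{k+1}Q_{k+1}(φ_kB,(φ_kB)ᶜ))/Σ_kμ_{k+1}(φ_kB)μ_{k+1}((φ_kB)ᶜ)`.
* **`flowHubEquivariantFrozen_spectralGap_le`** — images frozen (`Q_{k+1}(φ_kB,(φ_kB)ᶜ) = 0`) with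
  `μ_{k+1}(φ_kB)μ_{k+1}((φ_kB)ᶜ) ≥ v > 0` (`K ≥ 1`): `Gap ≤ t·min{μ_0(B),μ_0(Bᶜ)}/(K·v)` — THE LINEAR LAW, whatever the maps
  and the weights.

Reading (no numerics implied): on the hub as on the ladder, a map that carries a metastable hot-level set onto metastable
cold-level sets (the same sector, another sector, any bijective image) cannot raise the relaxation above order `K⁻¹`; with
`Scaling/FlowHubSchemeFloor` the hot-weighted map-assisted hub is `Θ(K)` two-sidedly for perfect transports WITHOUT any
sector hypothesis on the maps.  NOT CLAIMED: general swap graphs; anything measured.  Literature grade (cell rule): OWN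
COROLLARY; nothing cited as a fact; no new bib keys.
-/

noncomputable section

open Finset Function
open Literature.Probability.MarkovChains

namespace Summit.Ventures.LatticeQCDFlow.Scaling

variable {S : Type*} [Fintype S] [DecidableEq S] {K : ℕ} {μ : Fin (K + 1) → S → ℝ}
  {M : Fin (K + 1) → S → S → ℝ} {w : Fin (K + 1) → ℝ} {t : ℝ}

/-- **NO MAP ON THE HUB EDGES BEATS THE LINEAR LAW:** for every family of bijections `φ`, every probability vector `w`,
`0 ≤ t ≤ 1`, `|S| ≥ 2` and every set `B` with `Σ_kμ_{k+1}(φ_kB)μ_{k+1}((φ_kB)ᶜ) > 0`: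
`Gap(t·GSw^φ + (1−t)·Upd_w M) ≤ (t·min{μ_0(B),μ_0(Bᶜ)} + (1−t)Σ_kw_{k+1}Q_{k+1}(φ_kB,(φ_kB)ᶜ))/Σ_kμ_{k+1}(φ_kB)μ_{k+1}((φ_kB)ᶜ)`.
[ours] -/
theorem flowHubEquivariant_spectralGap_le [Nontrivial S] (φ : Fin K → Equiv.Perm S) (B : Finset S)
    (hμ : ∀ k x, 0 < μ k x) (hμ1 : ∀ k, ∑ u, μ k u = 1) (hM : ∀ k, IsRowStochastic (M k))
    (hMrev : ∀ k, DetailedBalance (μ k) (M k)) (hw0 : ∀ k, 0 ≤ w k) (hw1 : ∑ k, w k = 1) (ht0 : 0 ≤ t) (ht1 : t ≤ 1)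
    (hA : 0 < ∑ k : Fin K, (∑ x ∈ B.map (φ k).toEmbedding, μ k.succ x) * ∑ x ∈ (B.map (φ k).toEmbedding)ᶜ, μ k.succ x) :
    spectralGap (tensorFun μ) (fun x y : Fin (K + 1) → S =>
        t * ptGraphSwap μ (fun k : Fin K => ((0 : Fin (K + 1)), k.succ)) φ x y + (1 - t) * prodKernel w M x y)
      ≤ (t * min (∑ u ∈ B, μ 0 u) (∑ u ∈ Bᶜ, μ 0 u)
          + (1 - t) * ∑ k : Fin K, w k.succ * edgeMeasure (μ k.succ) (M k.succ) (B.map (φ k).toEmbedding)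
              (B.map (φ k).toEmbedding)ᶜ)
        / ∑ k : Fin K, (∑ x ∈ B.map (φ k).toEmbedding, μ k.succ x) * ∑ x ∈ (B.map (φ k).toEmbedding)ᶜ, μ k.succ x := by
  rw [flowStar_spectralGap_eq φ hμ t w]
  set L : Fin (K + 1) → Equiv.Perm S := Fin.cons (Equiv.refl S) (fun k => (φ k).symm) with hL
  have hL0u : ∀ u, (L 0).symm u = u := fun u => by rw [hL, starLevel_zero]; rfl
  have hLs : ∀ k : Fin K, (L k.succ).symm = φ k := fun k => by rw [hL, starLevel_succ, Equiv.symm_symm]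
  -- the pulled-back laws and updates, and the identity-map star
  have hν : ∀ k u, 0 < μ k ((L k).symm u) := fun k u => hμ k _
  have hν1 : ∀ k, ∑ u, μ k ((L k).symm u) = 1 := fun k => by rw [Equiv.sum_comp (L k).symm (μ k)]; exact hμ1 k
  have hM' : ∀ k, IsRowStochastic (fun u v => M k ((L k).symm u) ((L k).symm v)) := fun k =>
    ⟨fun u v => (hM k).1 _ _, fun u => by simpa using (Equiv.sum_comp (L k).symm (fun v => M k ((L k).symm u) v)).trans ((hM k).2 _)⟩
  have hM'rev : ∀ k, DetailedBalance (fun u => μ k ((L k).symm u)) (fun u v => M k ((L k).symm u) ((L k).symm v)) :=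
    fun k u v => hMrev k _ _
  set e : Fin K → Fin (K + 1) × Fin (K + 1) := fun k => ((0 : Fin (K + 1)), k.succ) with he_def
  have he : ∀ j, (e j).1 ≠ (e j).2 := fun k => (Fin.succ_ne_zero k).symm
  have hQ := ptGraphSwap_isRowStochastic (μ := fun i u => μ i ((L i).symm u)) (e := e) (φ := fun _ : Fin K => Equiv.refl S) hν
  have hQrev := ptGraphSwap_detailedBalance (μ := fun i u => μ i ((L i).symm u)) (e := e)
    (φ := fun _ : Fin K => Equiv.refl S) hν
  have hQA := ptGraphSwap_one_sectorCount_eq (μ := fun i u => μ i ((L i).symm u)) (e := e) he hν B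
  -- masses and exit flows of `B` under the pulled-back cold laws are those of the images `φ_k B`
  have hmass : ∀ k : Fin K, ∑ x ∈ B, μ k.succ ((L k.succ).symm x) = ∑ x ∈ B.map (φ k).toEmbedding, μ k.succ x :=
    fun k => by rw [hLs]; exact sum_relabel_set (φ k) B (μ k.succ)
  have hmassc : ∀ k : Fin K, ∑ x ∈ Bᶜ, μ k.succ ((L k.succ).symm x) = ∑ x ∈ (B.map (φ k).toEmbedding)ᶜ, μ k.succ x :=
    fun k => by rw [hLs, sum_relabel_set (φ k) Bᶜ (μ k.succ), map_compl_equiv]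
  have hedge : ∀ k : Fin K, edgeMeasure (fun u => μ k.succ ((L k.succ).symm u))
      (fun u v => M k.succ ((L k.succ).symm u) ((L k.succ).symm v)) B Bᶜ
      = edgeMeasure (μ k.succ) (M k.succ) (B.map (φ k).toEmbedding) (B.map (φ k).toEmbedding)ᶜ := fun k => by
    rw [hLs, edgeMeasure_relabel_set (φ k) (μ k.succ) (M k.succ) B Bᶜ, map_compl_equiv]
  -- the cold sums over `Fin (K+1)` with the `k = 0` term removed
  have hden : ∑ k : Fin (K + 1), (if k = 0 then (0 : ℝ) else (∑ u ∈ B, μ k ((L k).symm u)) * ∑ u ∈ Bᶜ, μ k ((L k).symm u))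
      = ∑ k : Fin K, (∑ x ∈ B.map (φ k).toEmbedding, μ k.succ x) * ∑ x ∈ (B.map (φ k).toEmbedding)ᶜ, μ k.succ x := by
    rw [Fin.sum_univ_succ, if_pos rfl, zero_add]
    exact sum_congr rfl fun k _ => by rw [if_neg (Fin.succ_ne_zero k), hmass, hmassc]
  have hnum : ∑ k : Fin (K + 1), w k * (if k = 0 then (0 : ℝ) else edgeMeasure (fun u => μ k ((L k).symm u))
        (fun u v => M k ((L k).symm u) ((L k).symm v)) B Bᶜ)
      = ∑ k : Fin K, w k.succ * edgeMeasure (μ k.succ) (M k.succ) (B.map (φ k).toEmbedding) (B.map (φ k).toEmbedding)ᶜ := by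
    rw [Fin.sum_univ_succ, if_pos rfl, mul_zero, zero_add]
    exact sum_congr rfl fun k _ => by rw [if_neg (Fin.succ_ne_zero k), hedge]
  have hA' : 0 < ∑ k : Fin (K + 1), (if k = 0 then (0 : ℝ) else (∑ u ∈ B, μ k ((L k).symm u)) * ∑ u ∈ Bᶜ, μ k ((L k).symm u)) := by
    rw [hden]; exact hA
  have h := handover_spectralGap_le (μ := fun i u => μ i ((L i).symm u))
    (M := fun i u v => M i ((L i).symm u) ((L i).symm v)) (w := w)
    (Q := ptGraphSwap (fun i u => μ i ((L i).symm u)) e (fun _ : Fin K => Equiv.refl S))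
    hν hν1 hM' hM'rev hw0 hw1 ht0 ht1 hQ hQrev hQA hA'
  rw [hden, hnum] at h
  refine h.trans (div_le_div_of_nonneg_right (add_le_add (mul_le_mul_of_nonneg_left (le_min ?_ ?_) ht0) le_rfl) hA.le)
  · have h1 := handoverFlow_le_hot (μ := fun i u => μ i ((L i).symm u)) hν hν1 hQ B
    simp only [hL0u] at h1; exact h1
  · have h2 := handoverFlow_le_hot_compl (μ := fun i u => μ i ((L i).symm u)) hν hν1 hQ hQrev B
    simp only [hL0u] at h2; exact h2

/-- **IMAGES FROZEN AT THE COLD LEVELS: THE LINEAR LAW, WHATEVER THE MAPS AND THE WEIGHTS:** `Q_{k+1}(φ_kB,(φ_kB)ᶜ) = 0`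
and `μ_{k+1}(φ_kB)μ_{k+1}((φ_kB)ᶜ) ≥ v > 0` for every `k` (`K ≥ 1`, `0 ≤ t ≤ 1`, `|S| ≥ 2`):
`Gap(t·GSw^φ + (1−t)·Upd_w M) ≤ t·min{μ_0(B),μ_0(Bᶜ)}/(K·v)`. [ours] -/
theorem flowHubEquivariantFrozen_spectralGap_le [Nontrivial S] (φ : Fin K → Equiv.Perm S) (B : Finset S) (hK : 1 ≤ K)
    (hμ : ∀ k x, 0 < μ k x) (hμ1 : ∀ k, ∑ u, μ k u = 1) (hM : ∀ k, IsRowStochastic (M k))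
    (hMrev : ∀ k, DetailedBalance (μ k) (M k)) (hw0 : ∀ k, 0 ≤ w k) (hw1 : ∑ k, w k = 1) (ht0 : 0 ≤ t) (ht1 : t ≤ 1)
    {v : ℝ} (hvpos : 0 < v)
    (hv : ∀ k : Fin K, v ≤ (∑ x ∈ B.map (φ k).toEmbedding, μ k.succ x) * ∑ x ∈ (B.map (φ k).toEmbedding)ᶜ, μ k.succ x)
    (hfrozen : ∀ k : Fin K, edgeMeasure (μ k.succ) (M k.succ) (B.map (φ k).toEmbedding) (B.map (φ k).toEmbedding)ᶜ = 0) :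
    spectralGap (tensorFun μ) (fun x y : Fin (K + 1) → S =>
        t * ptGraphSwap μ (fun k : Fin K => ((0 : Fin (K + 1)), k.succ)) φ x y + (1 - t) * prodKernel w M x y)
      ≤ t * min (∑ u ∈ B, μ 0 u) (∑ u ∈ Bᶜ, μ 0 u) / (K * v) := by
  have hKpos : (0 : ℝ) < K := Nat.cast_pos.mpr (by omega)
  have hVge : (K : ℝ) * v
      ≤ ∑ k : Fin K, (∑ x ∈ B.map (φ k).toEmbedding, μ k.succ x) * ∑ x ∈ (B.map (φ k).toEmbedding)ᶜ, μ k.succ x := by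
    calc (K : ℝ) * v = ∑ _k : Fin K, v := by rw [Finset.sum_const, Finset.card_univ, Fintype.card_fin, nsmul_eq_mul]
      _ ≤ _ := sum_le_sum fun k _ => hv k
  have hA := lt_of_lt_of_le (mul_pos hKpos hvpos) hVge
  have h := flowHubEquivariant_spectralGap_le φ B hμ hμ1 hM hMrev hw0 hw1 ht0 ht1 hA
  have h0 : ∑ k : Fin K, w k.succ * edgeMeasure (μ k.succ) (M k.succ) (B.map (φ k).toEmbedding) (B.map (φ k).toEmbedding)ᶜ
      = 0 := Finset.sum_eq_zero fun k _ => by rw [hfrozen k, mul_zero]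
  rw [h0, mul_zero, add_zero] at h
  have hnum : 0 ≤ t * min (∑ u ∈ B, μ 0 u) (∑ u ∈ Bᶜ, μ 0 u) :=
    mul_nonneg ht0 (le_min (sum_nonneg fun u _ => (hμ 0 u).le) (sum_nonneg fun u _ => (hμ 0 u).le))
  exact h.trans (div_le_div_of_nonneg_left hnum (by positivity) hVge)

end Summit.Ventures.LatticeQCDFlow.Scaling

end
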